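import Literature.MathematicalPhysics.QuantumFieldTheory.Balaban1983to89.B15ShellGauge193
import Literature.MathematicalPhysics.QuantumFieldTheory.Balaban1983to89.B16Sect1Wilson
import Literature.MathematicalPhysics.QuantumFieldTheory.Balaban1983to89.B16Sect1Statements
import Literature.MathematicalPhysics.QuantumFieldTheory.Balaban1983to89.B8Eq110UnitaryProof
import Literature.MathematicalPhysics.QuantumFieldTheory.Balaban1983to89.T4ShellCount

/-!
# `Balaban1983to89.B15Chi175LargeFieldFactor` — [Balaban1989LargeFieldI] p. 193: *"1 − χ_{k,Λ} is a large field
# function"* — the printed MECHANISM composed at field level on the torus carrier of `Setup`: a configuration in the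
# support of `1 − χ_{k,Λ}` (or of a background-mediated large-field function of [Balaban1988Convergent] (2.17) type)
# has a plaquette `p′ ⊂ Z ∩ Λᶜ` with `|V_k(∂p′) − 1| ≥ (O(1)B₃M²)⁻¹ε_k`, hence the Wilson action yields the factor
# `exp(−¼g⁻²K⁻¹ε_k²) ≤ exp(−A₁²p₀²(g_k))` ([Balaban1989LargeFieldII] p. 381) — stated at a LOWERED (live) threshold
# `μ·ε_k`, `0 < μ ≤ 1`, as the single-run shell reading of `T4IndicatorShell` §4 asks

statement-level skeleton of published theorems with citation tags; proofs where landed; nothing here is a claim about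
the Yang–Mills mass gap.

CITATION HEADER (lean-in-tree rule 2026-08-18).  T. Bałaban, *Large field renormalization. I. The basic step of the 𝐑
operation*, Commun. Math. Phys. **122**, 175–202 (1989), bib `Balaban1989LargeFieldI` (cell paper B15 = [IV]; p. 193 =
PDF p. 19), and *II. Localization, exponentiation, and bounds for the 𝐑 operation*, ibid. 355–392, bib
`Balaban1989LargeFieldII` (B16 = [V]; p. 381 = PDF p. 27).  The sentences were re-read on the tree's own verbatim
quotations (`B15.PrelimIntegrations.Extension193` ∕ `largeField193` ∕ `Chi175`, `B16Sect1Statements.prep381_chiΛ`,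
`B16Ineq382WilsonFactor` §3); nothing of the manuscripts is asserted as a fact: every estimate of Bałaban's that the
mechanism CONSUMES is an explicit binder below (the regularity transfer `hreg` of [Balaban1985Variational] Thm 1 ∕
[Balaban1988Convergent] (2.14)–(2.15) TYPE), and every conclusion is PROVED.

THE PRINTED TEXT ([IV] p. 193, verbatim, after (1.75)).  *"The corresponding configuration U_{k,Z} satisfies the
condition |∂U_{k,Z} − 1| < O(1)B₃M²εη². On the other hand, for any extension we have |∂U_{k,Z} − 1| ≧ 2ε_kη², hence
2ε_k < O(1)B₃M²ε, and |V_k(∂p′) − 1| > (O(1)B₃M²)⁻¹ε_k for some p′ ⊂ Z∩Λᶜ. This condition is enough to get the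
exponential small factor, estimating in the usual way the Wilson action. Thus 1 − χ_{k,Λ} is a large field function,
and we exclude from Z the components with this function."*  [V] p. 381: *"The function 1 − χ_{j,Λ} yields the factor
exp(−¼(1/g_j²)(O(1)B₃M²)⁻¹ε_j²) ≦ exp(−A₁²p₀²(g_j)), as it was proved in Sect. 1 [IV] after the definition (1.75) [IV]."*

WHAT WAS ALREADY IN THE TREE (used BY NAME, not restated): the extension lemma of p. 193 for a parallelepiped
(`B15ShellGauge193.extension193_shell_box`, typed leaf `B15.PrelimIntegrations.Extension193`), the arithmetic of the
second sentence (`B15.PrelimIntegrations.largeField193`), (1.75) in existential form (`B15.PrelimIntegrations.Chi175`),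
the Wilson-action mechanism on the `ℤ^d` matrix carrier (`B16Ineq382WilsonFactor.exp_wilsonSum_le_chiΛ`), the exponent
row of [V] p. 381 (`B16Sect1Statements.prep381_chiΛ`), the comparison `|g − 1|² ≤ 2N(1 − Re tr g)` on `SU(N)`∕`U(N)`
(`B8Eq110UnitaryProof.cmp'_specialUnitaryGroup` ∕ `cmp'_unitaryGroup`), the localized Wilson action `A(ζ, U)`
(`B16Sect1Wilson.wilsonLoc`) the single-run indicators `largeInd` ∕ `shellBelow` (`T4IndicatorShell` §3) and the inclusion «shell ⊂ large-field event at
the lowered threshold» (`T4ShellCount.shellBelow_le_largeInd`, S1 of the count × suppression route, whose PRINTED-SHAPE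
suppression hypothesis this file supplies at field level).
`B15Extension193`'s reading note (R5) records that *"the consequences drawn on p. 193 for χ_{k,Λ}"* were NOT yet composed
on the torus carrier; this file composes them.

WHAT IS HERE (all PROVED; torus `Site P k`, `GaugeField P k G`, any `[GaugeGroup G]` unless said otherwise).
* §1 THE LARGE-FIELD SIDE at field level.  `exists_large_plaquette_of_forall_extension` (abstract: an `Extension193`
  instance at level `a` + the regularity transfer `hreg` «|∂V̂ − 1| < δ everywhere ⇒ |∂U_{k,Z}(V̂) − 1| < Bδη² on S» + «every
  extension has a background plaquette `≥ θ`», `Bδη² ≤ θ` ⇒ a plaquette `p′` of `Z∩Λᶜ` with `|V(∂p′) − 1| ≥ a`);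
  `forall_extension_of_not_chi175` ((1.75)'s `¬χ_{k,Λ}` in the tree's existential form IS that hypothesis, `θ = 2ε′η²`);
  `exists_large_plaquette_of_not_chi175` (the printed numbers: `a = (C·B·M²)⁻¹ε′`, room factor 2 as in `largeField193`);
  and the extension-free twin `exists_large_plaquette_of_dev_ge` for a background-mediated function of (2.17) type
  ([Balaban1988Convergent] p. 257), whose large-field side is the bare contrapositive of `hreg`.
* §2 *"estimating in the usual way the Wilson action"*: for a gauge group with `|g − 1|² ≤ c_G(1 − Re tr g)` and a
  nonnegative plaquette weight `ζ` (the coupling profile `1/g_k(·)²` times a cut-off), one plaquette with `|V(∂p′) − 1| ≥ a`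
  gives `A(ζ, V) ≥ ζ(p′)c_G⁻¹a²` and `exp(−A(ζ, V)) ≤ exp(−ζ(p′)c_G⁻¹a²)` (`wilsonLoc_ge_of_large_plaquette`,
  `exp_neg_wilsonLoc_le_of_large_plaquette`).
* §3 THE COMPOSITION = p. 193's last two sentences: `exp_neg_wilsonLoc_le_of_not_chi175` and, in the indicator currency of
  `T4IndicatorShell` (the single-run large-field ∕ shell indicators of a tested variable `u` at a LOWERED threshold
  `2με_kη²`, `T4IndicatorShell` §4: «the small-factor exponent available at threshold (1 − ρ)θ»),
  `largeInd_mul_exp_neg_wilsonLoc_le` and `shellBelow_mul_exp_neg_wilsonLoc_le` — the pointwise single-run SHELL SMALL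
  FACTOR of one background-mediated slot, the in-edge «N12 ∕ [B15] p. 193» of the cell's node NE7c.
* §4 [V] p. 381's exponent row read with the live factor: `exp(−¼g⁻²K⁻¹(με)²) ≤ exp(−μ²A₁²p₀²(g))` under print's
  `ε = gA₀p₀(g)` and the ledger relation `4KA₁² ≤ A₀²` (homogeneous, hence `μ`-free) — `prep381_chiΛ` BY NAME at the
  amplitudes `(μA₀, μA₁)` (`prep381_chiΛ_live`) — and the rewriting of §3's exponent into that shape (`factor_exponent_eq`).
* §5 INSTANCES: `G = SU(N)` (`c_G = 2N`, `hcmp_specialUnitaryGroup`) and `Λ` = a parallelepiped of at most `M` sites per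
  direction in `d ≥ 3` (`C = 48d + 1`, ALL plaquettes regular for the extension): `exists_large_plaquette_box`,
  `largeInd_mul_exp_neg_wilsonLoc_le_box_specialUnitary` (the whole chain with the two instances plugged in).  The shell ⊂
  lowered-large-field inclusion is `T4ShellCount.shellBelow_le_largeInd` (S1 of the count × suppression route) BY NAME.

HONEST SCOPE ∕ READING NOTES.  (1) The ONE estimate of Bałaban's the mechanism consumes — *"The corresponding configuration
U_{k,Z} satisfies the condition |∂U_{k,Z} − 1| < O(1)B₃M²εη²"* (regularity of the minimizer over a regular field:
[Balaban1985Variational] Thm 1, [Balaban1988Convergent] (2.14)–(2.15)) — is the binder `hreg`, stated for an ABSTRACT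
background-deviation functional `dev : GaugeField P k G → Pl → ℝ` on an abstract plaquette range `S` (print: `p ∈ Ω_kᶜ` on the
fine lattice) up to a regularity ceiling `δ₀` (print: *"ε > 0 is sufficiently small"*); NOTHING about the minimizer is proved
here (node of record: [Balaban1985Variational] Thm 1 = the cell's N07).  (2) Constants: print's `(O(1)B₃M²)⁻¹ε_k` with `>`
is obtained as `((48d+1)·B·M²)⁻¹ε′ ≤ |V(∂p′) − 1|` (non-strict, a factor 2 to spare, exactly `largeField193`'s room); the
Wilson exponent comes out as `ζ(p′)·c_G⁻¹·a²` (`c_G = 2N` in the operator-norm reading — the printed `¼` is `(2N)⁻¹` at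
`N = 2`, cf. `B16Ineq382WilsonFactor` HONEST SCOPE (2)–(3): [IV] gives the square `(O(1)B₃M²)⁻²`, [V] prints the first
power; both are `O(1)` constants fixed before `A₀`, §4 takes `K` opaque).  (3) The live factor `μ ∈ (0, 1]` multiplies the
THRESHOLD only (`ε′ = με_k`); every constant of the chain is `μ`-free and the final exponent carries `μ²` — the loss class C1
of the cell's road (δ) (`Summits/…/Spine/NE7c/LiveFactorLargeField`, which reads the same [V] p. 381 row; this file is the
Literature-side FIELD-LEVEL source of that row for the `χ_{k,Λ}` ∕ (2.17) slots).  (4) NOT HERE: measures, the relative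
(integrated) weight of the shell — `T4IndicatorShell.ShellWeightBound` (NE7c) needs, besides this pointwise factor, the
survival ∕ entropy arithmetic of `T4WeightBudget` §3 and a positivity floor; nothing of that is touched.  No `def … : Prop`
hypothesis is minted; 0 sorry; axioms standard.
-/

noncomputable section

namespace Literature.MathematicalPhysics.QuantumFieldTheory.Balaban1983to89.B15Chi175LargeFieldFactor

open B15.PrelimIntegrations (Extension193 Chi175)
open B15Extension193 (outBonds outPlaqs boxSites)
open B15ShellGauge193 (extension193_shell_box)
open B16Sect1Wilson (wilsonLoc wilsonLoc_nonneg)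
open T4IndicatorShell (largeInd shellBelow)
open T4ShellCount (shellBelow_le_largeInd)
open GaugeField (plaqHol)

variable {P : Params} {k : ℕ} {G : Type*} [GaugeGroup G]

/-! ## §1  The large-field side of (1.75) ∕ (2.17) at field level -/

section LargePlaquette

variable {Pl : Type*}

/-- **p. 193, the large-field side, ABSTRACT FORM.**  Data: an extension property `Extension193 outB outP allP C M a`
(every field `a`-regular on the plaquettes `outP` of `Z∩Λᶜ` has an extension, equal to it on the bonds `outB`, that is
`CM²a`-regular on `allP`); a background deviation `dev W p` (print: `|U_{k,Z}(W)(∂p) − 1|`, `p ∈ Ω_kᶜ` = the range `S`)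
with the REGULARITY TRANSFER `hreg` (print: *"The corresponding configuration U_{k,Z} satisfies the condition
|∂U_{k,Z} − 1| < O(1)B₃M²εη²"*); and a field `V` *"for any extension [of which] we have |∂U_{k,Z} − 1| ≧ θ"* on some
plaquette of `S`.  If `B·(CM²a)·η² ≤ θ` then some plaquette `p′ ∈ outP` has `|V(∂p′) − 1| ≥ a` — print's *"|V_k(∂p′) − 1|
> (O(1)B₃M²)⁻¹ε_k for some p′ ⊂ Z∩Λᶜ"*. [cite: Balaban1989LargeFieldI, p.193 (mechanism of 1 − χ_{k,Λ})] -/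
theorem exists_large_plaquette_of_forall_extension {outB : Set (PBond P k)} {outP allP : Set (Plaq P k)}
    {C M a B η θ : ℝ} (hext : Extension193 (G := G) outB outP allP C M a)
    (dev : GaugeField P k G → Pl → ℝ) (S : Set Pl)
    (hreg : ∀ W : GaugeField P k G, PlaqSmallOn allP (C * M ^ 2 * a) W →
      ∀ p ∈ S, dev W p < B * (C * M ^ 2 * a) * η ^ 2)
    (hθ : B * (C * M ^ 2 * a) * η ^ 2 ≤ θ) {V : GaugeField P k G}
    (hlarge : ∀ W : GaugeField P k G, (∀ b ∈ outB, W b = V b) → ∃ p ∈ S, θ ≤ dev W p) :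
    ∃ p ∈ outP, a ≤ dist1 (plaqHol V p) := by
  by_contra h
  push Not at h
  obtain ⟨W, hWb, hWs⟩ := hext V h
  obtain ⟨p, hp, hθp⟩ := hlarge W hWb
  have := hreg W hWs p hp
  linarith

omit [GaugeGroup G] in
/-- **(1.75) negated, in the tree's existential letters.**  `¬ Chi175` over the extensions of `V` off the bonds `outB`
(`B15.PrelimIntegrations.Chi175`: *"this field has an extension on the whole domain Z, such that the extended field satisfies
the regularity condition in (1.75)"*) says exactly: every extension has a plaquette of the range `S` with background deviation
`≥ 2ε′η²`. [cite: Balaban1989LargeFieldI, (1.75) p.193] -/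
theorem forall_extension_of_not_chi175 {outB : Set (PBond P k)} (dev : GaugeField P k G → Pl → ℝ) (S : Set Pl)
    {ε' η : ℝ} {V : GaugeField P k G}
    (h : ¬ Chi175 (fun (e : {W : GaugeField P k G // ∀ b ∈ outB, W b = V b}) (p : Pl) => dev e.1 p) S ε' η) :
    ∀ W : GaugeField P k G, (∀ b ∈ outB, W b = V b) → ∃ p ∈ S, 2 * ε' * η ^ 2 ≤ dev W p := by
  intro W hW
  by_contra h'
  push Not at h'
  exact h ⟨⟨W, hW⟩, h'⟩

omit [GaugeGroup G] in
/-- … and conversely: if every extension has a background plaquette `≥ 2ε′η²` then `χ_{k,Λ}(V) = 0`. [cite: Balaban1989LargeFieldI, (1.75) p.193] -/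
theorem not_chi175_of_forall_extension {outB : Set (PBond P k)} (dev : GaugeField P k G → Pl → ℝ) (S : Set Pl)
    {ε' η : ℝ} {V : GaugeField P k G}
    (h : ∀ W : GaugeField P k G, (∀ b ∈ outB, W b = V b) → ∃ p ∈ S, 2 * ε' * η ^ 2 ≤ dev W p) :
    ¬ Chi175 (fun (e : {W : GaugeField P k G // ∀ b ∈ outB, W b = V b}) (p : Pl) => dev e.1 p) S ε' η := by
  rintro ⟨⟨W, hW⟩, hsmall⟩
  obtain ⟨p, hp, hle⟩ := h W hW
  have := hsmall p hp
  exact absurd this (not_lt.2 hle)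

/-- **p. 193, the large-field side WITH THE PRINTED NUMBERS (at a live threshold `ε′ = με_k`).**  With the regularity
transfer `hreg` valid up to a ceiling `δ₀` (*"ε > 0 is sufficiently small"*) and the extension property at the level
`a = (C·B·M²)⁻¹ε′`: if `χ_{k,Λ}(V) = 0` at threshold `2ε′η²` then `|V(∂p′) − 1| ≥ (C·B·M²)⁻¹ε′` for some `p′ ∈ outP`.  The
arithmetic is `largeField193`'s (`B·(CM²a)·η² = ε′η² ≤ 2ε′η²`). [cite: Balaban1989LargeFieldI, p.193 (mechanism of 1 − χ_{k,Λ})] -/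
theorem exists_large_plaquette_of_not_chi175 {outB : Set (PBond P k)} {outP allP : Set (Plaq P k)}
    {C M B η ε' δ₀ : ℝ} (hC : 0 < C) (hM : 0 < M) (hB : 0 < B) (hε' : 0 < ε')
    (hext : Extension193 (G := G) outB outP allP C M ((C * B * M ^ 2)⁻¹ * ε'))
    (dev : GaugeField P k G → Pl → ℝ) (S : Set Pl)
    (hreg : ∀ (W : GaugeField P k G) (δ : ℝ), 0 < δ → δ ≤ δ₀ → PlaqSmallOn allP δ W →
      ∀ p ∈ S, dev W p < B * δ * η ^ 2)
    (hδ₀ : B⁻¹ * ε' ≤ δ₀) {V : GaugeField P k G}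
    (hV : ¬ Chi175 (fun (e : {W : GaugeField P k G // ∀ b ∈ outB, W b = V b}) (p : Pl) => dev e.1 p) S ε' η) :
    ∃ p ∈ outP, (C * B * M ^ 2)⁻¹ * ε' ≤ dist1 (plaqHol V p) := by
  have hC' : C ≠ 0 := hC.ne'
  have hM' : M ≠ 0 := hM.ne'
  have hB' : B ≠ 0 := hB.ne'
  have hlev : C * M ^ 2 * ((C * B * M ^ 2)⁻¹ * ε') = B⁻¹ * ε' := by
    field_simp
  refine exists_large_plaquette_of_forall_extension (B := B) (η := η) (θ := 2 * ε' * η ^ 2) hext dev S ?_ ?_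
    (forall_extension_of_not_chi175 dev S hV)
  · intro W hW
    rw [hlev] at hW ⊢
    exact hreg W _ (by positivity) hδ₀ hW
  · rw [hlev]
    have : B * (B⁻¹ * ε') * η ^ 2 = ε' * η ^ 2 := by field_simp
    rw [this]
    nlinarith [sq_nonneg η]

/-- **The extension-free twin for a background-mediated function of (2.17) type** ([Balaban1988Convergent] p. 257:
`χ({sup_{p⊂□∼}|U_{k,□}(V_k, ∂p) − 1| < ε_kη²})`, the background `U_{k,□}(V_k)` tested directly, no infimum over extensions):
if the regularity transfer holds from the plaquettes `D` of the determining neighbourhood (*"|∂V − 1| < δ on D ⇒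
|U_{k,□}(V)(∂p) − 1| < Bδη² on S"*, up to the ceiling `δ₀`) and the background has a plaquette `≥ θ` on `S` with
`0 < θ`, `B⁻¹η⁻²θ ≤ δ₀`, then `V` itself has a plaquette `p′ ∈ D` with `|V(∂p′) − 1| ≥ B⁻¹η⁻²θ` — the bare contrapositive.
[cite: Balaban1988Convergent, (2.17) p.257] -/
theorem exists_large_plaquette_of_dev_ge {D : Set (Plaq P k)} {B η θ δ₀ : ℝ} (hB : 0 < B) (hη : 0 < η) (hθ : 0 < θ)
    (dev : GaugeField P k G → Pl → ℝ) (S : Set Pl)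
    (hreg : ∀ (W : GaugeField P k G) (δ : ℝ), 0 < δ → δ ≤ δ₀ → PlaqSmallOn D δ W →
      ∀ p ∈ S, dev W p < B * δ * η ^ 2)
    (hδ₀ : B⁻¹ * (η ^ 2)⁻¹ * θ ≤ δ₀) {V : GaugeField P k G} (hlarge : ∃ p ∈ S, θ ≤ dev V p) :
    ∃ p ∈ D, B⁻¹ * (η ^ 2)⁻¹ * θ ≤ dist1 (plaqHol V p) := by
  by_contra h
  push Not at h
  obtain ⟨p, hp, hθp⟩ := hlarge
  have h1 := hreg V _ (by positivity) hδ₀ h p hp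
  have hB' : B ≠ 0 := hB.ne'
  have hη' : η ≠ 0 := hη.ne'
  have h2 : B * (B⁻¹ * (η ^ 2)⁻¹ * θ) * η ^ 2 = θ := by
    field_simp
  linarith

end LargePlaquette

/-! ## §2  *"estimating in the usual way the Wilson action"* on the torus carrier -/

section Wilson

variable {cG : ℝ}

/-- The gauge-group comparison read as a lower bound on one plaquette term: `c_G⁻¹|g − 1|² ≤ 1 − Re tr g`.
[cite: Balaban1989LargeFieldI, p.193 (mechanism of 1 − χ_{k,Λ})] -/
theorem inv_mul_dist1_sq_le (hcmp : ∀ g : G, dist1 g ^ 2 ≤ cG * (1 - reTr g)) (hcG : 0 < cG) (g : G) :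
    cG⁻¹ * dist1 g ^ 2 ≤ 1 - reTr g := by
  rw [inv_mul_le_iff₀ hcG]
  exact hcmp g

/-- One term is below the localized Wilson action `A(ζ, V) = Σ_p ζ(p)[1 − Re tr V(∂p)]` (nonnegative weight).
[cite: Balaban1989LargeFieldII, (1.1) p.356] -/
theorem term_le_wilsonLoc (ζ : Plaq P k → ℝ) (hζ : ∀ p, 0 ≤ ζ p) (V : GaugeField P k G) (p' : Plaq P k) :
    ζ p' * (1 - reTr (plaqHol V p')) ≤ wilsonLoc ζ V := by
  unfold wilsonLoc
  refine Finset.single_le_sum (f := fun p => ζ p * (1 - reTr (plaqHol V p))) (fun p _ => ?_) (Finset.mem_univ p')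
  have := GaugeGroup.reTr_le_one (plaqHol V p)
  exact mul_nonneg (hζ p) (by linarith)

/-- **One large plaquette bounds the Wilson action from below**: `|V(∂p′) − 1| ≥ a ≥ 0` gives
`A(ζ, V) ≥ ζ(p′)·c_G⁻¹·a²`. [cite: Balaban1989LargeFieldI, p.193 (mechanism of 1 − χ_{k,Λ})] -/
theorem wilsonLoc_ge_of_large_plaquette (hcmp : ∀ g : G, dist1 g ^ 2 ≤ cG * (1 - reTr g)) (hcG : 0 < cG)
    (ζ : Plaq P k → ℝ) (hζ : ∀ p, 0 ≤ ζ p) {V : GaugeField P k G} {p' : Plaq P k} {a : ℝ} (ha : 0 ≤ a)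
    (hp' : a ≤ dist1 (plaqHol V p')) :
    ζ p' * (cG⁻¹ * a ^ 2) ≤ wilsonLoc ζ V := by
  have h1 : cG⁻¹ * a ^ 2 ≤ cG⁻¹ * dist1 (plaqHol V p') ^ 2 :=
    mul_le_mul_of_nonneg_left (pow_le_pow_left₀ ha hp' 2) (inv_nonneg.2 hcG.le)
  have h2 := inv_mul_dist1_sq_le hcmp hcG (plaqHol V p')
  exact (mul_le_mul_of_nonneg_left (h1.trans h2) (hζ p')).trans (term_le_wilsonLoc ζ hζ V p')

/-- **"the Wilson action yields the factor"**: `exp(−A(ζ, V)) ≤ exp(−ζ(p′)c_G⁻¹a²)` as soon as one plaquette has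
`|V(∂p′) − 1| ≥ a` (the weight `ζ` carries the coupling, e.g. `ζ = 1/g_k(·)²` on the relevant plaquettes).
[cite: Balaban1989LargeFieldI, p.193 (mechanism of 1 − χ_{k,Λ})] -/
theorem exp_neg_wilsonLoc_le_of_large_plaquette (hcmp : ∀ g : G, dist1 g ^ 2 ≤ cG * (1 - reTr g)) (hcG : 0 < cG)
    (ζ : Plaq P k → ℝ) (hζ : ∀ p, 0 ≤ ζ p) {V : GaugeField P k G} {p' : Plaq P k} {a : ℝ} (ha : 0 ≤ a)
    (hp' : a ≤ dist1 (plaqHol V p')) :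
    Real.exp (-wilsonLoc ζ V) ≤ Real.exp (-(ζ p' * (cG⁻¹ * a ^ 2))) :=
  Real.exp_le_exp.2 (neg_le_neg (wilsonLoc_ge_of_large_plaquette hcmp hcG ζ hζ ha hp'))

/-- The same with print's global prefactor `1/g²` displayed: `exp(−g⁻²A(ζ, V)) ≤ exp(−g⁻²ζ(p′)c_G⁻¹a²)`.
[cite: Balaban1989LargeFieldI, p.193 (mechanism of 1 − χ_{k,Λ})] -/
theorem exp_neg_wilsonLoc_le_of_large_plaquette' (hcmp : ∀ g : G, dist1 g ^ 2 ≤ cG * (1 - reTr g)) (hcG : 0 < cG)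
    (ζ : Plaq P k → ℝ) (hζ : ∀ p, 0 ≤ ζ p) {V : GaugeField P k G} {p' : Plaq P k} {a : ℝ} (ha : 0 ≤ a)
    (hp' : a ≤ dist1 (plaqHol V p')) (g : ℝ) :
    Real.exp (-(1 / g ^ 2 * wilsonLoc ζ V)) ≤ Real.exp (-(1 / g ^ 2 * (ζ p' * (cG⁻¹ * a ^ 2)))) := by
  refine Real.exp_le_exp.2 (neg_le_neg (mul_le_mul_of_nonneg_left ?_ (by positivity)))
  exact wilsonLoc_ge_of_large_plaquette hcmp hcG ζ hζ ha hp'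

end Wilson

/-! ## §3  The composition: the single-run large-field ∕ shell small factor of one background-mediated slot -/

section Composition

variable {Pl : Type*} {cG : ℝ}

/-- **[IV] p. 193 COMPOSED: `1 − χ_{k,Λ}` carries the exponential small factor.**  For a field with `χ_{k,Λ}(V) = 0` at
the (live) threshold `2ε′η²`, and a plaquette weight `ζ ≥ 0` with `ζ ≥ w ≥ 0` on the plaquettes of `Z∩Λᶜ`:
`exp(−A(ζ, V)) ≤ exp(−w·c_G⁻¹·((C·B·M²)⁻¹ε′)²)`.  CONDITIONAL on the regularity transfer `hreg` and the extension property
`hext`; nothing of Bałaban's asserted. [cite: Balaban1989LargeFieldI, p.193 (mechanism of 1 − χ_{k,Λ})] -/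
theorem exp_neg_wilsonLoc_le_of_not_chi175 {outB : Set (PBond P k)} {outP allP : Set (Plaq P k)}
    {C M B η ε' δ₀ w : ℝ} (hC : 0 < C) (hM : 0 < M) (hB : 0 < B) (hε' : 0 < ε')
    (hext : Extension193 (G := G) outB outP allP C M ((C * B * M ^ 2)⁻¹ * ε'))
    (dev : GaugeField P k G → Pl → ℝ) (S : Set Pl)
    (hreg : ∀ (W : GaugeField P k G) (δ : ℝ), 0 < δ → δ ≤ δ₀ → PlaqSmallOn allP δ W →
      ∀ p ∈ S, dev W p < B * δ * η ^ 2)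
    (hδ₀ : B⁻¹ * ε' ≤ δ₀) (hcmp : ∀ g : G, dist1 g ^ 2 ≤ cG * (1 - reTr g)) (hcG : 0 < cG)
    (ζ : Plaq P k → ℝ) (hζ : ∀ p, 0 ≤ ζ p) (hw : ∀ p ∈ outP, w ≤ ζ p) {V : GaugeField P k G}
    (hV : ¬ Chi175 (fun (e : {W : GaugeField P k G // ∀ b ∈ outB, W b = V b}) (p : Pl) => dev e.1 p) S ε' η) :
    Real.exp (-wilsonLoc ζ V) ≤ Real.exp (-(w * (cG⁻¹ * ((C * B * M ^ 2)⁻¹ * ε') ^ 2))) := by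
  obtain ⟨p', hp', hle⟩ := exists_large_plaquette_of_not_chi175 hC hM hB hε' hext dev S hreg hδ₀ hV
  have ha : 0 ≤ (C * B * M ^ 2)⁻¹ * ε' := by positivity
  refine (exp_neg_wilsonLoc_le_of_large_plaquette hcmp hcG ζ hζ ha hle).trans (Real.exp_le_exp.2 (neg_le_neg ?_))
  exact mul_le_mul_of_nonneg_right (hw p' hp') (by positivity)

/-- An indicator times a nonnegative quantity is bounded by `Y ≥ 0` as soon as the bound holds ON the indicated event.
[folklore] -/
private theorem largeInd_mul_le {u θ X Y : ℝ} (hY : 0 ≤ Y) (h : θ ≤ u → X ≤ Y) : largeInd u θ * X ≤ Y := by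
  unfold largeInd
  split_ifs with hu
  · rw [one_mul]; exact h hu
  · rw [zero_mul]; exact hY

/-- **THE SINGLE-RUN LARGE-FIELD SMALL FACTOR OF ONE `χ_{k,Λ}`-SLOT AT A LOWERED THRESHOLD** (indicator currency of
`T4IndicatorShell`): for a tested variable `u` of the slot whose large-field event `{2ε′η² ≤ u}` implies `χ_{k,Λ}(V) = 0` at
threshold `2ε′η²` (e.g. `u = inf over extensions of sup_p |U_{k,Z}(∂p) − 1|`, `ε′ = με_k`), the indicator-weighted Wilson
factor obeys `1[2ε′η² ≤ u]·exp(−A(ζ, V)) ≤ exp(−w·c_G⁻¹·((C·B·M²)⁻¹ε′)²)`.  CONDITIONAL on `hreg`, `hext`.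
[cite: Balaban1989LargeFieldI, p.193 (mechanism of 1 − χ_{k,Λ})] -/
theorem largeInd_mul_exp_neg_wilsonLoc_le {outB : Set (PBond P k)} {outP allP : Set (Plaq P k)}
    {C M B η ε' δ₀ w : ℝ} (hC : 0 < C) (hM : 0 < M) (hB : 0 < B) (hε' : 0 < ε')
    (hext : Extension193 (G := G) outB outP allP C M ((C * B * M ^ 2)⁻¹ * ε'))
    (dev : GaugeField P k G → Pl → ℝ) (S : Set Pl)
    (hreg : ∀ (W : GaugeField P k G) (δ : ℝ), 0 < δ → δ ≤ δ₀ → PlaqSmallOn allP δ W →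
      ∀ p ∈ S, dev W p < B * δ * η ^ 2)
    (hδ₀ : B⁻¹ * ε' ≤ δ₀) (hcmp : ∀ g : G, dist1 g ^ 2 ≤ cG * (1 - reTr g)) (hcG : 0 < cG)
    (ζ : Plaq P k → ℝ) (hζ : ∀ p, 0 ≤ ζ p) (hw : ∀ p ∈ outP, w ≤ ζ p) {V : GaugeField P k G} {u : ℝ}
    (hu : 2 * ε' * η ^ 2 ≤ u →
      ¬ Chi175 (fun (e : {W : GaugeField P k G // ∀ b ∈ outB, W b = V b}) (p : Pl) => dev e.1 p) S ε' η) :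
    largeInd u (2 * ε' * η ^ 2) * Real.exp (-wilsonLoc ζ V) ≤
      Real.exp (-(w * (cG⁻¹ * ((C * B * M ^ 2)⁻¹ * ε') ^ 2))) :=
  largeInd_mul_le (Real.exp_pos _).le fun h =>
    exp_neg_wilsonLoc_le_of_not_chi175 hC hM hB hε' hext dev S hreg hδ₀ hcmp hcG ζ hζ hw (hu h)

/-- **THE SINGLE-RUN SHELL SMALL FACTOR** (node NE7c's in-edge «N12 ∕ [B15] p. 193», `T4IndicatorShell` §4): the shell
`1[2ε_kη² − Δ ≤ u < 2ε_kη²]` below the slot's threshold, of width `Δ = 2(ε_k − ε′)η²` (so that the lowered threshold is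
`2ε′η²`, `ε′ = (1 − ρ)ε_k`), carries the large-field factor of the LOWERED threshold:
`1[shell]·exp(−A(ζ, V)) ≤ exp(−w·c_G⁻¹·((C·B·M²)⁻¹ε′)²)`.  CONDITIONAL on `hreg`, `hext`; the relative-weight statement
`ShellWeightBound` is NOT touched. [cite: Balaban1989LargeFieldI, p.193 (mechanism of 1 − χ_{k,Λ})] -/
theorem shellBelow_mul_exp_neg_wilsonLoc_le {outB : Set (PBond P k)} {outP allP : Set (Plaq P k)}
    {C M B η ε' εk δ₀ w : ℝ} (hC : 0 < C) (hM : 0 < M) (hB : 0 < B) (hε' : 0 < ε')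
    (hext : Extension193 (G := G) outB outP allP C M ((C * B * M ^ 2)⁻¹ * ε'))
    (dev : GaugeField P k G → Pl → ℝ) (S : Set Pl)
    (hreg : ∀ (W : GaugeField P k G) (δ : ℝ), 0 < δ → δ ≤ δ₀ → PlaqSmallOn allP δ W →
      ∀ p ∈ S, dev W p < B * δ * η ^ 2)
    (hδ₀ : B⁻¹ * ε' ≤ δ₀) (hcmp : ∀ g : G, dist1 g ^ 2 ≤ cG * (1 - reTr g)) (hcG : 0 < cG)
    (ζ : Plaq P k → ℝ) (hζ : ∀ p, 0 ≤ ζ p) (hw : ∀ p ∈ outP, w ≤ ζ p) {V : GaugeField P k G} {u : ℝ}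
    (hu : 2 * ε' * η ^ 2 ≤ u →
      ¬ Chi175 (fun (e : {W : GaugeField P k G // ∀ b ∈ outB, W b = V b}) (p : Pl) => dev e.1 p) S ε' η) :
    shellBelow u (2 * εk * η ^ 2) (2 * (εk - ε') * η ^ 2) * Real.exp (-wilsonLoc ζ V) ≤
      Real.exp (-(w * (cG⁻¹ * ((C * B * M ^ 2)⁻¹ * ε') ^ 2))) := by
  have hsh := shellBelow_le_largeInd u (2 * εk * η ^ 2) (2 * (εk - ε') * η ^ 2)
  have e : 2 * εk * η ^ 2 - 2 * (εk - ε') * η ^ 2 = 2 * ε' * η ^ 2 := by ring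
  rw [e] at hsh
  exact (mul_le_mul_of_nonneg_right hsh (Real.exp_pos _).le).trans
    (largeInd_mul_exp_neg_wilsonLoc_le hC hM hB hε' hext dev S hreg hδ₀ hcmp hcG ζ hζ hw hu)

/-- **The (2.17)-type slot, composed**: a background-mediated large-field event `{θ ≤ dev V p for some p ∈ S}` of a
function testing the background directly carries `exp(−A(ζ, V)) ≤ exp(−w·c_G⁻¹·(B⁻¹η⁻²θ)²)` whenever `ζ ≥ w ≥ 0` on the
determining plaquettes `D`.  CONDITIONAL on `hreg`. [cite: Balaban1988Convergent, (2.17) p.257] -/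
theorem exp_neg_wilsonLoc_le_of_dev_ge {D : Set (Plaq P k)} {B η θ δ₀ w : ℝ} (hB : 0 < B) (hη : 0 < η) (hθ : 0 < θ)
    (dev : GaugeField P k G → Pl → ℝ) (S : Set Pl)
    (hreg : ∀ (W : GaugeField P k G) (δ : ℝ), 0 < δ → δ ≤ δ₀ → PlaqSmallOn D δ W →
      ∀ p ∈ S, dev W p < B * δ * η ^ 2)
    (hδ₀ : B⁻¹ * (η ^ 2)⁻¹ * θ ≤ δ₀) (hcmp : ∀ g : G, dist1 g ^ 2 ≤ cG * (1 - reTr g)) (hcG : 0 < cG)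
    (ζ : Plaq P k → ℝ) (hζ : ∀ p, 0 ≤ ζ p) (hw : ∀ p ∈ D, w ≤ ζ p) {V : GaugeField P k G}
    (hlarge : ∃ p ∈ S, θ ≤ dev V p) :
    Real.exp (-wilsonLoc ζ V) ≤ Real.exp (-(w * (cG⁻¹ * (B⁻¹ * (η ^ 2)⁻¹ * θ) ^ 2))) := by
  obtain ⟨p', hp', hle⟩ := exists_large_plaquette_of_dev_ge hB hη hθ dev S hreg hδ₀ hlarge
  have ha : 0 ≤ B⁻¹ * (η ^ 2)⁻¹ * θ := by positivity
  refine (exp_neg_wilsonLoc_le_of_large_plaquette hcmp hcG ζ hζ ha hle).trans (Real.exp_le_exp.2 (neg_le_neg ?_))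
  exact mul_le_mul_of_nonneg_right (hw p' hp') (by positivity)

end Composition

/-! ## §4  [V] p. 381's exponent row read with the live factor -/

section Exponent

/-- The exponent of §3 (weight `w = 1/g²` on the plaquettes of `Z∩Λᶜ`) in the shape of [V] p. 381:
`g⁻²·c_G⁻¹·(K′⁻¹ε′)² = ¼g⁻²K⁻¹ε′²` with `K = c_G K′²/4`. [cite: Balaban1989LargeFieldII, p.381 (after (1.76))] -/
theorem factor_exponent_eq {cG K' ε' g : ℝ} (hcG : 0 < cG) (hK' : 0 < K') (hg : g ≠ 0) :
    1 / g ^ 2 * (cG⁻¹ * (K'⁻¹ * ε') ^ 2) = 1 / 4 * (1 / g ^ 2) * (cG * K' ^ 2 / 4)⁻¹ * ε' ^ 2 := by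
  have hcG' : cG ≠ 0 := hcG.ne'
  have hK'' : K' ≠ 0 := hK'.ne'
  field_simp

/-- **[V] p. 381, the row of `1 − χ_{j,Λ}`, LIVE**: with the threshold amplitude multiplied by `μ`
(`ε′ = g·(μA₀)·p₀(g)`, i.e. `ε′ = με_j` in the [III] (2.4) dictionary `ε_j = g_jA₀p₀(g_j)`), r13's
`B16Sect1Statements.prep381_chiΛ` at the amplitudes `(μA₀, μA₁)` — the ledger relation `4KA₁² ≤ A₀²` is homogeneous, so it
transfers — gives `exp(−¼g⁻²K⁻¹ε′²) ≤ exp(−μ²A₁²p₀(g)²)`: the large-field exponent carries `μ²` and nothing else moves.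
[cite: Balaban1989LargeFieldII, p.381 (after (1.76))] -/
theorem prep381_chiΛ_live {g K ε' A₀ p₀g A₁ μ : ℝ} (hg : g ≠ 0) (hK : 0 < K)
    (hε : ε' = g * (μ * A₀) * p₀g) (hR3 : 4 * K * A₁ ^ 2 ≤ A₀ ^ 2) :
    Real.exp (-(1 / 4 * (1 / g ^ 2) * K⁻¹ * ε' ^ 2)) ≤ Real.exp (-(μ ^ 2 * (A₁ ^ 2 * p₀g ^ 2))) := by
  have hR3' : 4 * K * (μ * A₁) ^ 2 ≤ (μ * A₀) ^ 2 := by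
    have hμ : 0 ≤ μ ^ 2 := sq_nonneg μ
    nlinarith [mul_le_mul_of_nonneg_left hR3 hμ]
  have h := B16Sect1Statements.prep381_chiΛ (A₁ := μ * A₁) hg hK hε hR3'
  have e : (μ * A₁) ^ 2 * p₀g ^ 2 = μ ^ 2 * (A₁ ^ 2 * p₀g ^ 2) := by ring
  rwa [e] at h

/-- **§3's factor in print's final letters**: with the weight `w = 1/g²` on the plaquettes of `Z∩Λᶜ`,
`exp(−g⁻²c_G⁻¹(K′⁻¹ε′)²) ≤ exp(−μ²A₁²p₀(g)²)` under `ε′ = g(μA₀)p₀(g)` and the ledger relation `c_G K′² A₁² ≤ A₀²` (an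
`O(1)`-type lower bound on `A₀/A₁`, admissible because `A₀` is fixed after `M`; cell ledger GAPS G-B16-07 R3 read with
`K = c_G K′²/4`, `K′ = O(1)B₃M²`). [cite: Balaban1989LargeFieldII, p.381 (after (1.76))] -/
theorem factor_le_exp_neg_live {cG K' ε' g A₀ p₀g A₁ μ : ℝ} (hcG : 0 < cG) (hK' : 0 < K') (hg : g ≠ 0)
    (hε : ε' = g * (μ * A₀) * p₀g) (hR3 : cG * K' ^ 2 * A₁ ^ 2 ≤ A₀ ^ 2) :
    Real.exp (-(1 / g ^ 2 * (cG⁻¹ * (K'⁻¹ * ε') ^ 2))) ≤ Real.exp (-(μ ^ 2 * (A₁ ^ 2 * p₀g ^ 2))) := by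
  rw [factor_exponent_eq hcG hK' hg]
  have hK : 0 < cG * K' ^ 2 / 4 := by positivity
  have hR3K : 4 * (cG * K' ^ 2 / 4) * A₁ ^ 2 ≤ A₀ ^ 2 := by
    have : 4 * (cG * K' ^ 2 / 4) = cG * K' ^ 2 := by ring
    rw [this]; exact hR3
  exact prep381_chiΛ_live hg hK hε hR3K

end Exponent

/-! ## §5  Instances: `G = SU(N)` and `Λ` a parallelepiped (`d ≥ 3`) -/

section Instances

/-- The gauge-group comparison of §2 for `G = SU(N)` (the cell's instance `UnitaryModel.instGaugeGroupSpecialUnitaryGroup`,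
operator norm): `|g − 1|² ≤ 2N(1 − Re tr g)` — `B8Eq110UnitaryProof.cmp'_specialUnitaryGroup` BY NAME, `c_G = 2N`.
[cite: Balaban1985RegularSpaces, (1.10) p.77] -/
theorem hcmp_specialUnitaryGroup {N : ℕ} [NeZero N] (g : Matrix.specialUnitaryGroup (Fin N) ℂ) :
    dist1 g ^ 2 ≤ (2 * (N : ℝ)) * (1 - reTr g) := by
  have h := B8Eq110UnitaryProof.cmp'_specialUnitaryGroup g
  rwa [Fintype.card_fin] at h

/-- The same for `G = U(N)` (`UnitaryModel.instGaugeGroupUnitaryGroup`). [cite: Balaban1985RegularSpaces, (1.10) p.77] -/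
theorem hcmp_unitaryGroup {N : ℕ} [NeZero N] (g : Matrix.unitaryGroup (Fin N) ℂ) :
    dist1 g ^ 2 ≤ (2 * (N : ℝ)) * (1 - reTr g) := by
  have h := B8Eq110UnitaryProof.cmp'_unitaryGroup g
  rwa [Fintype.card_fin] at h

variable {Pl : Type*} {lo hi : Fin P.d → ℤ}

/-- **p. 193 for the PRINTED `Λ` = a parallelepiped** (*"Λ is a rectangular parallelepiped contained in a cube of the size
100M"*, p. 192; `d ≥ 3`, at most `n + 1 ≤ M` sites per direction, non-wrapping with margin): the extension property is
`B15ShellGauge193.extension193_shell_box` (ALL plaquettes regular, `C = 48d + 1`), so `χ_{k,Λ}(V) = 0` at threshold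
`2ε′η²` gives a plaquette `p′` of `Λᶜ` with `|V(∂p′) − 1| ≥ ((48d + 1)·B·M²)⁻¹ε′`.  CONDITIONAL on the regularity transfer
`hreg` only. [cite: Balaban1989LargeFieldI, p.193 (mechanism of 1 − χ_{k,Λ})] -/
theorem exists_large_plaquette_box (hd : 3 ≤ P.d) (hlohi : lo ≤ hi) {n : ℕ} (hn : ∀ κ, hi κ ≤ lo κ + n)
    (hN : ∀ κ, hi κ - lo κ + 3 < (P.sitesPerDir k : ℤ)) {M : ℝ} (hM : (n : ℝ) + 1 ≤ M)
    {B η ε' δ₀ : ℝ} (hB : 0 < B) (hε' : 0 < ε') (dev : GaugeField P k G → Pl → ℝ) (S : Set Pl)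
    (hreg : ∀ (W : GaugeField P k G) (δ : ℝ), 0 < δ → δ ≤ δ₀ → PlaqSmallOn Set.univ δ W →
      ∀ p ∈ S, dev W p < B * δ * η ^ 2)
    (hδ₀ : B⁻¹ * ε' ≤ δ₀) {V : GaugeField P k G}
    (hV : ¬ Chi175 (fun (e : {W : GaugeField P k G // ∀ b ∈ outBonds (boxSites lo hi), W b = V b}) (p : Pl) =>
      dev e.1 p) S ε' η) :
    ∃ p ∈ outPlaqs (boxSites lo hi), ((48 * (P.d : ℝ) + 1) * B * M ^ 2)⁻¹ * ε' ≤ dist1 (plaqHol V p) := by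
  have hC : (0 : ℝ) < 48 * (P.d : ℝ) + 1 := by positivity
  have hM0 : 0 < M := by have : (0 : ℝ) ≤ n := n.cast_nonneg; linarith
  exact exists_large_plaquette_of_not_chi175 hC hM0 hB hε'
    (extension193_shell_box (G := G) hd hlohi hn hN hM _) dev S hreg hδ₀ hV

/-- **THE WHOLE CHAIN WITH BOTH INSTANCES PLUGGED IN** (`G = SU(N)`, `Λ` a parallelepiped, weight `ζ ≥ 0` with
`ζ ≥ w ≥ 0` on the plaquettes of `Λᶜ`): the single-run large-field indicator of the slot at the lowered threshold `2ε′η²`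
times the Wilson factor is `≤ exp(−w·(2N)⁻¹·(((48d+1)·B·M²)⁻¹ε′)²)`.  CONDITIONAL on the regularity transfer `hreg`
([Balaban1985Variational] Thm 1 TYPE for the background `dev`); nothing of Bałaban's asserted; NOT `ShellWeightBound`.
[cite: Balaban1989LargeFieldI, p.193 (mechanism of 1 − χ_{k,Λ})] -/
theorem largeInd_mul_exp_neg_wilsonLoc_le_box_specialUnitary {N : ℕ} [NeZero N] (hd : 3 ≤ P.d) (hlohi : lo ≤ hi)
    {n : ℕ} (hn : ∀ κ, hi κ ≤ lo κ + n) (hN : ∀ κ, hi κ - lo κ + 3 < (P.sitesPerDir k : ℤ)) {M : ℝ}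
    (hM : (n : ℝ) + 1 ≤ M) {B η ε' δ₀ w : ℝ} (hB : 0 < B) (hε' : 0 < ε')
    (dev : GaugeField P k (Matrix.specialUnitaryGroup (Fin N) ℂ) → Pl → ℝ) (S : Set Pl)
    (hreg : ∀ (W : GaugeField P k (Matrix.specialUnitaryGroup (Fin N) ℂ)) (δ : ℝ), 0 < δ → δ ≤ δ₀ →
      PlaqSmallOn Set.univ δ W → ∀ p ∈ S, dev W p < B * δ * η ^ 2)
    (hδ₀ : B⁻¹ * ε' ≤ δ₀) (ζ : Plaq P k → ℝ) (hζ : ∀ p, 0 ≤ ζ p)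
    (hw : ∀ p ∈ outPlaqs (boxSites (k := k) lo hi), w ≤ ζ p)
    {V : GaugeField P k (Matrix.specialUnitaryGroup (Fin N) ℂ)} {u : ℝ}
    (hu : 2 * ε' * η ^ 2 ≤ u → ¬ Chi175 (fun (e : {W : GaugeField P k (Matrix.specialUnitaryGroup (Fin N) ℂ) //
      ∀ b ∈ outBonds (boxSites lo hi), W b = V b}) (p : Pl) => dev e.1 p) S ε' η) :
    largeInd u (2 * ε' * η ^ 2) * Real.exp (-wilsonLoc ζ V) ≤
      Real.exp (-(w * ((2 * (N : ℝ))⁻¹ * (((48 * (P.d : ℝ) + 1) * B * M ^ 2)⁻¹ * ε') ^ 2))) := by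
  have hC : (0 : ℝ) < 48 * (P.d : ℝ) + 1 := by positivity
  have hM0 : 0 < M := by have : (0 : ℝ) ≤ n := n.cast_nonneg; linarith
  have hcG : (0 : ℝ) < 2 * (N : ℝ) := by
    have : (0 : ℝ) < N := by exact_mod_cast Nat.pos_of_ne_zero (NeZero.ne N)
    linarith
  exact largeInd_mul_exp_neg_wilsonLoc_le hC hM0 hB hε' (extension193_shell_box hd hlohi hn hN hM _) dev S hreg hδ₀
    hcmp_specialUnitaryGroup hcG ζ hζ hw hu

end Instances

end Literature.MathematicalPhysics.QuantumFieldTheory.Balaban1983to89.B15Chi175LargeFieldFactor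

end
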